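import Summits.ResolutionOfSingularities.ResolutionOfSingularities.Theorems.FrobeniusClosingPatchingRelPerfectAlgebraizeBlowup
import Summits.ResolutionOfSingularities.ResolutionOfSingularities.Theorems.FrobeniusClosingPatchingRelPerfectBlowupBaseChange
import Literature.AlgebraicGeometry.Resolution.ModuleBlowup
import Literature.AlgebraicGeometry.Resolution.BlowupsScaling
import Literature.AlgebraicGeometry.Resolution.BlowupsIntegral
import HarnessLib

/-!
# Crux `PatchingRelPerfect` (stmt-ResolutionOfSingularities-16161), chain w52, task W5:
# P0 re-glue stub α — completion descent in BLOW-UP FORM (`stub_algebraizeBlowupForm`)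

[OURS · L1 W5.2 · W5] The planner's v4 proposal P0 (CHAIN.md v0.1 §3) replaces the open core by
its blow-up form (`T` a blowing up of `Spec S` along a non-zero ideal, regular off the closed
fibre).  The completion-descent stub must then be re-glued in the same form:

  `stub_algebraizeBlowupForm : ∀ p, p.Prime → PunctualCompletePerfectBlowup p 4 → PunctualPerfClosedBlowup p 4`

(typed target `ChainW52.PunctualPerfClosedBlowup`; both predicates written UNFOLDED here).  This
file is the landed proof of `stub_algebraizeBlowup` (p168252, Temkin 2008 Thm. 3.4.1 with
`T ×_S Spec Ŝ`) re-run VERBATIM with two changes: (1) integrality of `T`, properness and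
birationality of `f` are now CONSEQUENCES of `T = Bl_I Spec S`, `I ≠ 0`
(`IsBlowup.isIntegral`, `IsBlowup.isProper`, `IsBlowup.isBirational'`); (2) at Step 3 the
complete-side atom is invoked in blow-up form, for which `T̂ = T ×_S Spec Ŝ ⟶ Spec Ŝ` is shown to
be the blowing up along `(I Ŝ)~` (blow-ups commute with the flat base change `Spec Ŝ → Spec S`:
`IsBlowup.pullback_snd_SpecMap_of_flat`, Mathlib's flatness of `AdicCompletion`) with `I Ŝ ≠ 0`
(`S → Ŝ` injective).  Steps 1–2 and 4–7 are CALLED from / identical to the landed helpers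
(`FrobeniusClosingPatchingRelPerfectAlgebraizeBlowupHelpers.lean`, p167566).

Nothing here is a statement of the manuscript under review; no definition or named fact is
introduced.

## Sources

* M. Temkin, Adv. Math. 219 (2008), Thm. 3.4.1 (proof, p. 18), Lemma 3.1.4, Cor. 3.1.5. [Temkin2008]
* U. Görtz, T. Wedhorn, *Algebraic Geometry I* (2nd ed., 2020), Def. 13.90, Prop. 13.91. [GortzWedhorn2020]
* H. Matsumura, *Commutative Ring Theory*, CUP 1986, Thm. 23.7. [Matsumura1987]
-/

set_option linter.dupNamespace false -- single-problem summit: doubled namespace component is forced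

noncomputable section

open CategoryTheory CategoryTheory.Limits AlgebraicGeometry Literature.AlgebraicGeometry.Resolution
open IsLocalRing TensorProduct TopologicalSpace

namespace Summit.ResolutionOfSingularities.ResolutionOfSingularities.Theorems

/-- **Completion descent in blow-up format, BLOW-UP FORM of the base scheme**
(`PunctualCompletePerfectBlowup p 4 → PunctualPerfClosedBlowup p 4`, P0 stub α
`stub_algebraizeBlowupForm`, typed target `ChainW52.PunctualPerfClosedBlowup` unfolded).
Let `k` be perfect of characteristic `p`, `S` regular local, essentially of finite type over `k`,
`dim S ≤ 4`, `S/𝔪` finite over `k`, `I ≠ 0` an ideal of `S` and `f : T → Spec S` a blowing up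
along `Ĩ` with `T` regular off the closed fibre. Then `T` is integral, `f` proper birational;
`Ŝ` is regular local of the same dimension, characteristic `p`, complete, residue field `S/𝔪`
perfect, `S → Ŝ` regular and injective; `T̂ = T ×_S Spec Ŝ → Spec Ŝ` is the blowing up along
`(I Ŝ)~` (flat base change), `I Ŝ ≠ 0`, `T̂` integral and regular off the closed fibre. The
blow-up-form atom `hB` over `Ŝ` gives a non-zero centre `Ĵ` on `T̂`, cosupported in the closed
fibre, with `Bl_Ĵ T̂` regular; `Ĵ = J₀ 𝒪_T̂` for `J₀ = φ_* Ĵ ∩ 𝒪_T` (`Ĵ ⊇ (𝔪𝒪_T̂)ᴺ`), `J₀ ≠ 0`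
cosupported in the closed fibre, `Bl_{J₀} T ×_T T̂ ≅ Bl_Ĵ T̂` regular, and regularity descends
along the flat projection / holds off the closed fibre. Verbatim the proof of
`stub_algebraizeBlowup` except Step 3.
[cite: Temkin2008, Thm. 3.4.1 (proof, p. 18), Lemma 3.1.4, Cor. 3.1.5]
[cite: GortzWedhorn2020, Def. 13.90 and Prop. 13.91] [cite: Matsumura1987, Thm. 23.7] -/
theorem stub_algebraizeBlowupForm (p : ℕ) (hp : p.Prime)
    (hB : ∀ (S : Type) [CommRing S] [IsRegularLocalRing S] [CharP S p]
      [IsAdicComplete (IsLocalRing.maximalIdeal S) S]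
      [PerfectField (IsLocalRing.ResidueField S)], ringKrullDim S ≤ (4 : ℕ) →
      ∀ (I : Ideal S), I ≠ ⊥ → ∀ (T : Scheme.{0}) (f : T ⟶ Spec (.of S)),
        IsBlowup f (affineBlowup.idealSheaf I) →
        (∀ t : T, f.base t ≠ IsLocalRing.closedPoint S → IsRegularLocalRing (T.presheaf.stalk t)) →
        ∃ (J : T.IdealSheafData) (T' : Scheme.{0}) (π : T' ⟶ T), J ≠ ⊥ ∧
          (∀ t : T, t ∈ J.support → f.base t = IsLocalRing.closedPoint S) ∧
          IsBlowup π J ∧ Scheme.IsRegular T')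
    (k : Type) [Field k] [CharP k p] [PerfectField k] (S : Type) [CommRing S] [IsRegularLocalRing S]
    [Algebra k S] [Algebra.EssFiniteType k S] (hdim : ringKrullDim S ≤ (4 : ℕ))
    (hfin : Module.Finite k (S ⧸ IsLocalRing.maximalIdeal S)) (I : Ideal S) (hI : I ≠ ⊥)
    (T : Scheme.{0}) (f : T ⟶ Spec (.of S)) (hf : IsBlowup f (affineBlowup.idealSheaf I))
    (hoff : ∀ t : T, f.base t ≠ IsLocalRing.closedPoint S → IsRegularLocalRing (T.presheaf.stalk t)) :
    ∃ (J : T.IdealSheafData) (T' : Scheme.{0}) (π : T' ⟶ T), J ≠ ⊥ ∧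
      (∀ t : T, t ∈ J.support → f.base t = IsLocalRing.closedPoint S) ∧
      IsBlowup π J ∧ Scheme.IsRegular T' := by
  have _ := hp -- the primality of `p` is not used
  -- Noetherian bookkeeping downstairs
  haveI : IsNoetherianRing (CommRingCat.of S) := (inferInstance : IsNoetherianRing S)
  haveI : IsDomain S := isDomain_of_isRegularLocalRing S
  -- `T = Bl_I Spec S` is integral, proper and birational over `Spec S`
  have hI' : affineBlowup.idealSheaf I ≠ ⊥ := affineBlowup.idealSheaf_ne_bot hI
  haveI : IsIntegral T := hf.isIntegral hI'
  haveI : IsProper f := hf.isProper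
  have hbir : IsBirational f := hf.isBirational' hI'
  haveI : IsLocallyNoetherian T := LocallyOfFiniteType.isLocallyNoetherian f
  have hfg : (maximalIdeal S).FG := (maximalIdeal S).fg_of_isNoetherianRing
  -- Step 1: the completion `Ŝ` and its structure
  let E : Type := AdicCompletion (maximalIdeal S) S
  haveI : IsRegularLocalRing E := isRegularLocalRing_adicCompletion S
  haveI : IsDomain E := isDomain_of_isRegularLocalRing E
  haveI : IsNoetherianRing (CommRingCat.of E) := (inferInstance : IsNoetherianRing E)
  obtain ⟨hchar, hperf, hREG⟩ := stub_algebraizeBlowupCompletion p k S hfin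
  haveI : CharP E p := hchar
  haveI : PerfectField (ResidueField E) := hperf
  have hdimE : ringKrullDim E ≤ (4 : ℕ) := by
    have h1 : ringKrullDim E = ringKrullDim S := ringKrullDim_adicCompletion S
    rw [h1]
    exact hdim
  haveI : Module.Flat S E := inferInstance
  have hinj : Function.Injective (algebraMap S E) :=
    AdicCompletion.of_injective (maximalIdeal S) S
  let g : Spec (.of E) ⟶ Spec (.of S) := specOfAlgebra S E
  haveI : Flat g := by
    refine (HasRingHomProperty.Spec_iff (P := @Flat)).mpr ?_
    change (algebraMap S E).Flat
    exact RingHom.flat_algebraMap_iff.mpr inferInstance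
  have hclosed : ∀ q : Spec (.of E), g q = closedPoint S ↔ q = closedPoint E :=
    specMap_eq_closedPoint_iff S
  -- Step 2: the base change `T̂ = T ×_S Spec Ŝ`
  let Th : Scheme.{0} := pullback f g
  let φ : Th ⟶ T := pullback.fst f g
  let fh : Th ⟶ Spec (.of E) := pullback.snd f g
  haveI : Flat φ := MorphismProperty.pullback_fst _ _ inferInstance
  haveI : IsProper fh := MorphismProperty.pullback_snd _ _ inferInstance
  have hbirh : IsBirational fh := isBirational_pullback_snd_specMap hinj f hbir
  haveI : IrreducibleSpace (Spec (.of E) : Scheme.{0}) :=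
    inferInstanceAs (IrreducibleSpace (PrimeSpectrum E))
  haveI : IrreducibleSpace Th := hbirh.irreducibleSpace
  haveI : IsReduced Th := isReduced_pullback_specMap_of_isRegularHom E hREG f
  haveI : IsIntegral Th := isIntegral_of_irreducibleSpace_of_isReduced Th
  haveI : IsLocallyNoetherian Th := LocallyOfFiniteType.isLocallyNoetherian fh
  haveI : CompactSpace Th := QuasiCompact.compactSpace_of_compactSpace fh
  have hfφ : ∀ z : Th, f (φ z) = g (fh z) := fun z => by
    rw [← Scheme.Hom.comp_apply, ← Scheme.Hom.comp_apply, pullback.condition]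
  -- `T̂` is regular off the closed fibre (regular ascent along `φ`)
  have hoffh : ∀ z : Th, fh.base z ≠ closedPoint E → IsRegularLocalRing (Th.presheaf.stalk z) := by
    intro z hz
    refine isRegularLocalRing_stalk_pullback_of_isRegularHom E hREG f z (hoff _ fun h1 => hz ?_)
    exact (hclosed _).mp ((hfφ z).symm.trans h1)
  -- Step 3: `T̂ ⟶ Spec Ŝ` is the blowing up along `(I Ŝ)~` (blow-ups commute with the flat base
  -- change `Spec Ŝ → Spec S`), `I Ŝ ≠ 0`; the blow-up-form atom over the complete base applies
  have hfh : IsBlowup fh (affineBlowup.idealSheaf (I.map (algebraMap S E))) :=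
    hf.pullback_snd_SpecMap_of_flat
  have hIE : I.map (algebraMap S E) ≠ ⊥ := by
    intro h0
    exact hI ((Ideal.map_eq_bot_iff_of_injective hinj).mp h0)
  obtain ⟨Jh, Th', πh, hJh0, hJhsupp, hπh, hTh'reg⟩ :=
    hB E hdimE (I.map (algebraMap S E)) hIE Th fh hfh hoffh
  -- Step 4: the closed-fibre ideal sheaves `G = 𝔪 𝒪_T`, `H = 𝔪 𝒪_T̂ = φ⁻¹ G`
  let sM : Ideal Γ(Spec (.of S), ⊤) := (maximalIdeal S).map (Scheme.ΓSpecIso (.of S)).inv.hom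
  let G : T.IdealSheafData := (Scheme.IdealSheafData.ofIdealTop sM).comap f
  have hGsupp : ∀ t : T, t ∈ (G.support : Set T) ↔ f t = closedPoint S := by
    intro t
    change t ∈ (((Scheme.IdealSheafData.ofIdealTop sM).comap f).support : Set T) ↔ _
    rw [Scheme.IdealSheafData.support_comap, TopologicalSpace.Closeds.coe_preimage,
      Set.mem_preimage, Scheme.IdealSheafData.coe_support_ofIdealTop, Scheme.mem_zeroLocus_iff]
    have hbo : ∀ s : Γ(Spec (.of S), ⊤), f t ∈ (Spec (.of S)).basicOpen s ↔
        (Scheme.ΓSpecIso (.of S)).hom.hom s ∉ (f t).asIdeal := fun s => by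
      rw [basicOpen_eq_of_affine']
      rfl
    have hsurj : Function.Surjective (Scheme.ΓSpecIso (.of S)).inv.hom :=
      (Scheme.ΓSpecIso (.of S)).commRingCatIsoToRingEquiv.symm.surjective
    constructor
    · intro hall
      have hle : maximalIdeal S ≤ (f t).asIdeal := fun m hm => by
        have h1 := hall ((Scheme.ΓSpecIso (.of S)).inv.hom m) (Ideal.mem_map_of_mem _ hm)
        rw [hbo, not_not, ← CommRingCat.comp_apply, Iso.inv_hom_id, CommRingCat.id_apply] at h1
        exact h1
      apply PrimeSpectrum.ext
      exact ((IsLocalRing.maximalIdeal.isMaximal S).eq_of_le (f t).2.ne_top hle).symm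
    · intro ht s hs hts
      obtain ⟨m, hm, rfl⟩ := (Ideal.mem_map_iff_of_surjective _ hsurj).mp hs
      rw [hbo, ← CommRingCat.comp_apply, Iso.inv_hom_id, CommRingCat.id_apply, ht] at hts
      exact hts hm
  let H : Th.IdealSheafData := G.comap φ
  have hHsupp : ∀ z : Th, z ∈ (H.support : Set Th) ↔ fh z = closedPoint E := by
    intro z
    change z ∈ ((G.comap φ).support : Set Th) ↔ _
    rw [Scheme.IdealSheafData.support_comap, TopologicalSpace.Closeds.coe_preimage,
      Set.mem_preimage, hGsupp, hfφ, hclosed]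
  -- Step 5: `Ĵ ⊇ Hᴺ⁺¹`, so `Ĵ` is extended from `J₀ = φ_* Ĵ ∩ 𝒪_T`
  have hJhH : (Jh.support : Set Th) ⊆ H.support := fun z hz => (hHsupp z).mpr (hJhsupp z hz)
  obtain ⟨N, hN⟩ := exists_pow_succ_le_of_support_subset hJhH
  haveI : IsAffineHom g := inferInstance
  haveI : IsAffineHom φ := MorphismProperty.pullback_fst _ _ inferInstance
  let J₀ : T.IdealSheafData := Jh.map φ
  have hJcomap : J₀.comap φ = Jh :=
    comap_map_fst_eq_of_pow_le E (maximalIdeal S) (N + 1)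
      (fun B _ _ w => exists_sub_tmul_one_mem_map_pow (maximalIdeal S) hfg (N + 1) B w) f Jh hN
  have hJ0ne : J₀ ≠ ⊥ := by
    intro h0
    apply hJh0
    rw [← hJcomap, h0, Scheme.IdealSheafData.comap_bot]
  have hJ0G : (J₀.support : Set T) ⊆ G.support := by
    change ((Jh.map φ).support : Set T) ⊆ _
    rw [Scheme.IdealSheafData.support_map, TopologicalSpace.Closeds.coe_closure]
    refine G.support.isClosed.closure_subset_iff.mpr ?_
    rintro _ ⟨z, hz, rfl⟩
    exact (hGsupp _).mpr (by rw [hfφ]; exact (hclosed _).mpr (hJhsupp z hz))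
  have hJ0supp : ∀ t : T, t ∈ J₀.support → f.base t = closedPoint S :=
    fun t ht => (hGsupp t).mp (hJ0G ht)
  -- Step 6: blow up `T` along `J₀`; its base change to `Ŝ` is `Bl_Ĵ T̂`, regular
  obtain ⟨T', π', hπ'⟩ := exists_isBlowup T J₀
  haveI : IsProper π' := hπ'.isProper
  haveI : IsLocallyNoetherian T' := LocallyOfFiniteType.isLocallyNoetherian π'
  let Th' : Scheme.{0} := pullback (π' ≫ f) g
  let φ' : Th' ⟶ T' := pullback.fst (π' ≫ f) g
  haveI : Flat φ' := MorphismProperty.pullback_fst _ _ inferInstance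
  have tsq : IsPullback φ fh f g := IsPullback.of_hasPullback f g
  have bigsq : IsPullback φ' (pullback.snd (π' ≫ f) g) (π' ≫ f) g := IsPullback.of_hasPullback _ _
  have sq := IsPullback.of_bot' bigsq tsq
  have hρ : IsBlowup (tsq.lift (φ' ≫ π') (pullback.snd (π' ≫ f) g)
      (by rw [Category.assoc, bigsq.w])) Jh := by
    have := hπ'.of_isPullback_of_flat sq
    rwa [hJcomap] at this
  obtain ⟨e, -, -⟩ := hρ.unique hπh
  have hTh'reg2 : Scheme.IsRegular Th' := fun z =>
    (Scheme.mem_regularLocus _).mp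
      ((mem_regularLocus_iff_of_flat_of_isPreimmersion e.hom z).mpr
        ((Scheme.mem_regularLocus _).mpr (hTh'reg _)))
  -- Step 7: `Bl_{J₀} T` is regular
  have hT'reg : Scheme.IsRegular T' := by
    intro y₁
    by_cases hy : f (π' y₁) = closedPoint S
    · -- over the closed point: a point of `Bl_Ĵ T̂` above `y₁`, and flat descent
      have hcond : (π' ≫ f) y₁ = g (closedPoint E) := by
        rw [Scheme.Hom.comp_apply, hy, (hclosed _).mpr rfl]
      obtain ⟨z₁, hz₁, -⟩ :=
        Scheme.Pullback.exists_preimage_pullback (f := π' ≫ f) (g := g) y₁ (closedPoint E) hcond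
      haveI : IsRegularLocalRing (Th'.presheaf.stalk z₁) := hTh'reg2 z₁
      subst hz₁
      exact IsRegularLocalRing.of_flat_ringHom (φ'.stalkMap z₁).hom (Flat.stalkMap φ' z₁)
    · -- off the closed fibre: `π'` is an isomorphism near `y₁` and `T` is regular there
      have h1 : π' y₁ ∉ (J₀.support : Set T) := fun h => hy (hJ0supp _ h)
      haveI := hπ'.isIso_compl
      refine (Scheme.mem_regularLocus _).mp ((mem_regularLocus_iff_of_isIso_morphismRestrict π'
        ⟨(J₀.support : Set T)ᶜ, J₀.support.isClosed.isOpen_compl⟩ y₁ h1).mpr ?_)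
      exact (Scheme.mem_regularLocus _).mpr (hoff _ hy)
  exact ⟨J₀, T', π', hJ0ne, hJ0supp, hπ', hT'reg⟩

end Summit.ResolutionOfSingularities.ResolutionOfSingularities.Theorems

end
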